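import Mathlib

/-!
# Hidden-fibration certificate: `π₁(P ×_c S¹) ≅ F(ξ, η) ⋊_swap ℤ` (algebraic core of THEOREM 11.19)

Solo residency `solo-SmoothPoincare4-informed`, session 13; algebraic core of THEOREM 11.19(a) of the
residency file `paper/poincare-sphere-trick.md` (a prose result under adjudication, not a theorem of this
tree).

Geometric provenance (prose, not formalised here).  `T ⊂ S³` the trefoil, `c` complex conjugation,
`W = S³ ×_c S¹`, `P ⊂ S³` the `c`-invariant punctured Klein bottle with `∂P = T` (THEOREM 11.16),
`N_P = P ×_c S¹ ⊂ W` with `π₁(N_P) = ⟨u, s ∣ [s², u]⟩` (`u` the core loop of `P`, `s` the flow circle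
through a fixed point, `v = s u s⁻¹ = c_* u`, `[∂P] = u² v⁻²`).  THEOREM 11.19 asserts that `N_P` also
fibres over the circle with fibre a once-punctured torus `T₀` and monodromy the orientation-reversing
involution `τ̄` swapping a symplectic basis `ξ, η` of `π₁(T₀) = F(ξ, η)`, that the section curve
`γ_t = u·s` is the fibre curve `ξ`, and that `[∂P]` is the commutator `[ξ, η]`; the solid-Klein-bottle
filling of THEOREM 11.18 is then the page filling of `ξ`.

What is proved here (pure group theory, kernel-checked):
* `equivGH : G ≃* H` where `G = ⟨u, s ∣ s s u s⁻¹ s⁻¹ u⁻¹⟩` and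
  `H = ⟨a, b, r ∣ r a r⁻¹ b⁻¹, r b r⁻¹ a⁻¹⟩` (the standard presentation of `F(a, b) ⋊_swap ℤ`),
  given by `u ↦ a r⁻¹`, `s ↦ r`, with inverse `a ↦ u s`, `b ↦ s u`, `r ↦ s`;
* `phi_section` : the section class `u s` goes to the fibre generator `a`;
* `phi_boundary` : the boundary class `u u s u⁻¹ u⁻¹ s⁻¹ = u² v⁻²` goes to `a b a⁻¹ b⁻¹`;
* `degA_comp_phi`, `degB_comp_phi` : the two fibration classes `φ_A = s*` (fibre `P`) and
  `φ_B = s* − u*` (fibre `T₀`) correspond to `a, b, r ↦ 1, 1, 1` and `a, b, r ↦ 0, 0, 1` on `H`.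
-/

set_option maxRecDepth 8000

namespace Summit.SmoothPoincare4.SmoothPoincare4.Theorems
namespace HiddenFibration

open Multiplicative

/-! ## The two presentations -/

/-- Generator `u` of `π₁(N_P)`. -/
def gu : FreeGroup Bool := FreeGroup.of false
/-- Generator `s` of `π₁(N_P)`. -/
def gs : FreeGroup Bool := FreeGroup.of true

/-- The relator `s s u s⁻¹ s⁻¹ u⁻¹` (`s²` commutes with `u`). -/
def relG : FreeGroup Bool := gs * gs * gu * gs⁻¹ * gs⁻¹ * gu⁻¹

/-- Relator set of `G = π₁(N_P)`. -/
def relsG : Set (FreeGroup Bool) := {relG}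

/-- `G = ⟨u, s ∣ [s², u]⟩`. -/
abbrev G : Type := PresentedGroup relsG

/-- `relG_mem` (generator-level bookkeeping lemma). -/
theorem relG_mem : relG ∈ relsG := by simp [relsG]

/-- Generators of `H`: `a, b` (fibre) and `r` (stable letter). -/
inductive Gen
  | a | b | r
  deriving DecidableEq

/-- Generator `a`. -/
def ha : FreeGroup Gen := FreeGroup.of Gen.a
/-- Generator `b`. -/
def hb : FreeGroup Gen := FreeGroup.of Gen.b
/-- Generator `r`. -/
def hr : FreeGroup Gen := FreeGroup.of Gen.r

/-- Relator `r a r⁻¹ b⁻¹`. -/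
def relH1 : FreeGroup Gen := hr * ha * hr⁻¹ * hb⁻¹
/-- Relator `r b r⁻¹ a⁻¹`. -/
def relH2 : FreeGroup Gen := hr * hb * hr⁻¹ * ha⁻¹

/-- Relator set of `H = F(a,b) ⋊_swap ℤ`. -/
def relsH : Set (FreeGroup Gen) := {relH1, relH2}

/-- `H = ⟨a, b, r ∣ r a r⁻¹ = b, r b r⁻¹ = a⟩`. -/
abbrev H : Type := PresentedGroup relsH

/-- `relH1_mem` (generator-level bookkeeping lemma). -/
theorem relH1_mem : relH1 ∈ relsH := by simp [relsH]
/-- `relH2_mem` (generator-level bookkeeping lemma). -/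
theorem relH2_mem : relH2 ∈ relsH := by simp [relsH]

/-! ## Consequences of the relators -/

/-- In `G`: `s s u s⁻¹ s⁻¹ u⁻¹ = 1`. -/
theorem G_rel :
    (PresentedGroup.of true : G) * PresentedGroup.of true * PresentedGroup.of false *
      (PresentedGroup.of true)⁻¹ * (PresentedGroup.of true)⁻¹ * (PresentedGroup.of false)⁻¹ = 1 := by
  have h : PresentedGroup.mk relsG relG = 1 := PresentedGroup.one_of_mem relG_mem
  simpa [relG, gu, gs, PresentedGroup.of] using h

/-- In `H`: `r a r⁻¹ = b`. -/
theorem H_conj_a :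
    (PresentedGroup.of Gen.r : H) * PresentedGroup.of Gen.a * (PresentedGroup.of Gen.r)⁻¹ =
      PresentedGroup.of Gen.b := by
  have h : PresentedGroup.mk relsH relH1 = 1 := PresentedGroup.one_of_mem relH1_mem
  have h' : (PresentedGroup.of Gen.r : H) * PresentedGroup.of Gen.a * (PresentedGroup.of Gen.r)⁻¹ *
      (PresentedGroup.of Gen.b)⁻¹ = 1 := by
    simpa [relH1, ha, hb, hr, PresentedGroup.of] using h
  exact mul_inv_eq_one.mp h'

/-- In `H`: `r b r⁻¹ = a`. -/
theorem H_conj_b :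
    (PresentedGroup.of Gen.r : H) * PresentedGroup.of Gen.b * (PresentedGroup.of Gen.r)⁻¹ =
      PresentedGroup.of Gen.a := by
  have h : PresentedGroup.mk relsH relH2 = 1 := PresentedGroup.one_of_mem relH2_mem
  have h' : (PresentedGroup.of Gen.r : H) * PresentedGroup.of Gen.b * (PresentedGroup.of Gen.r)⁻¹ *
      (PresentedGroup.of Gen.a)⁻¹ = 1 := by
    simpa [relH2, ha, hb, hr, PresentedGroup.of] using h
  exact mul_inv_eq_one.mp h'

/-- In `H`: `r⁻¹ a r = b` (from `r b r⁻¹ = a`). -/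
theorem H_conj_a' :
    (PresentedGroup.of Gen.r : H)⁻¹ * PresentedGroup.of Gen.a * PresentedGroup.of Gen.r =
      PresentedGroup.of Gen.b := by
  calc (PresentedGroup.of Gen.r : H)⁻¹ * PresentedGroup.of Gen.a * PresentedGroup.of Gen.r
        = (PresentedGroup.of Gen.r)⁻¹ *
            ((PresentedGroup.of Gen.r) * PresentedGroup.of Gen.b * (PresentedGroup.of Gen.r)⁻¹) *
            PresentedGroup.of Gen.r := by rw [H_conj_b]
    _ = PresentedGroup.of Gen.b := by group

/-! ## `Φ : G →* H`, `u ↦ a r⁻¹`, `s ↦ r` -/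

/-- Images of the generators of `G` in `H`. -/
def phiGen : Bool → H
  | false => PresentedGroup.of Gen.a * (PresentedGroup.of Gen.r)⁻¹
  | true => PresentedGroup.of Gen.r

/-- `phiGen_false` (generator-level bookkeeping lemma). -/
@[simp] theorem phiGen_false :
    phiGen false = PresentedGroup.of Gen.a * (PresentedGroup.of Gen.r)⁻¹ := rfl
/-- `phiGen_true` (generator-level bookkeeping lemma). -/
@[simp] theorem phiGen_true : phiGen true = PresentedGroup.of Gen.r := rfl

/-- `Φ` kills the relator of `G`: `r r (a r⁻¹) r⁻¹ r⁻¹ (a r⁻¹)⁻¹ = r (r a r⁻¹) r⁻¹ a⁻¹ = r b r⁻¹ a⁻¹ = 1`. -/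
theorem lift_phiGen_relG : FreeGroup.lift phiGen relG = 1 := by
  simp only [relG, gu, gs, map_mul, map_inv, FreeGroup.lift_apply_of, phiGen_false, phiGen_true]
  calc (PresentedGroup.of Gen.r : H) * PresentedGroup.of Gen.r *
          (PresentedGroup.of Gen.a * (PresentedGroup.of Gen.r)⁻¹) *
          (PresentedGroup.of Gen.r)⁻¹ * (PresentedGroup.of Gen.r)⁻¹ *
          (PresentedGroup.of Gen.a * (PresentedGroup.of Gen.r)⁻¹)⁻¹
        = PresentedGroup.of Gen.r *
            (PresentedGroup.of Gen.r * PresentedGroup.of Gen.a * (PresentedGroup.of Gen.r)⁻¹) *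
            (PresentedGroup.of Gen.r)⁻¹ * (PresentedGroup.of Gen.a)⁻¹ := by group
    _ = 1 := by rw [H_conj_a, H_conj_b, mul_inv_cancel]

/-- `Φ : G →* H`. -/
def phi : G →* H :=
  PresentedGroup.toGroup (f := phiGen) (by
    intro w hw
    simp only [relsG, Set.mem_singleton_iff] at hw
    subst hw
    exact lift_phiGen_relG)

/-- `phi_of` (generator-level bookkeeping lemma). -/
@[simp] theorem phi_of (x : Bool) : phi (PresentedGroup.of x) = phiGen x := by
  simp [phi]

/-! ## `Ψ : H →* G`, `a ↦ u s`, `b ↦ s u`, `r ↦ s` -/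

/-- Images of the generators of `H` in `G`. -/
def psiGen : Gen → G
  | Gen.a => PresentedGroup.of false * PresentedGroup.of true
  | Gen.b => PresentedGroup.of true * PresentedGroup.of false
  | Gen.r => PresentedGroup.of true

/-- `psiGen_a` (generator-level bookkeeping lemma). -/
@[simp] theorem psiGen_a : psiGen Gen.a = PresentedGroup.of false * PresentedGroup.of true := rfl
/-- `psiGen_b` (generator-level bookkeeping lemma). -/
@[simp] theorem psiGen_b : psiGen Gen.b = PresentedGroup.of true * PresentedGroup.of false := rfl
/-- `psiGen_r` (generator-level bookkeeping lemma). -/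
@[simp] theorem psiGen_r : psiGen Gen.r = PresentedGroup.of true := rfl

/-- `Ψ(r a r⁻¹ b⁻¹) = s (u s) s⁻¹ (s u)⁻¹ = 1` already in the free group. -/
theorem lift_psiGen_relH1 : FreeGroup.lift psiGen relH1 = 1 := by
  simp only [relH1, ha, hb, hr, map_mul, map_inv, FreeGroup.lift_apply_of, psiGen_a, psiGen_b, psiGen_r]
  group

/-- `Ψ(r b r⁻¹ a⁻¹) = s s u s⁻¹ s⁻¹ u⁻¹`, the relator of `G`. -/
theorem lift_psiGen_relH2 : FreeGroup.lift psiGen relH2 = 1 := by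
  simp only [relH2, ha, hb, hr, map_mul, map_inv, FreeGroup.lift_apply_of, psiGen_a, psiGen_b, psiGen_r]
  calc (PresentedGroup.of true : G) * (PresentedGroup.of true * PresentedGroup.of false) *
          (PresentedGroup.of true)⁻¹ * (PresentedGroup.of false * PresentedGroup.of true)⁻¹
        = PresentedGroup.of true * PresentedGroup.of true * PresentedGroup.of false *
            (PresentedGroup.of true)⁻¹ * (PresentedGroup.of true)⁻¹ * (PresentedGroup.of false)⁻¹ := by
          group
    _ = 1 := G_rel

/-- `Ψ : H →* G`. -/
def psi : H →* G :=
  PresentedGroup.toGroup (f := psiGen) (by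
    intro w hw
    simp only [relsH, Set.mem_insert_iff, Set.mem_singleton_iff] at hw
    rcases hw with rfl | rfl
    · exact lift_psiGen_relH1
    · exact lift_psiGen_relH2)

/-- `psi_of` (generator-level bookkeeping lemma). -/
@[simp] theorem psi_of (x : Gen) : psi (PresentedGroup.of x) = psiGen x := by
  simp [psi]

/-! ## The two composites are the identity -/

/-- `Ψ ∘ Φ = id` (`u ↦ a r⁻¹ ↦ u s s⁻¹ = u`, `s ↦ r ↦ s`). -/
theorem psi_comp_phi : psi.comp phi = MonoidHom.id G := by
  ext x
  cases x with
  | false => simp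
  | true => simp

/-- `Φ ∘ Ψ = id` (`a ↦ u s ↦ a r⁻¹ r = a`, `b ↦ s u ↦ r a r⁻¹ = b`, `r ↦ s ↦ r`). -/
theorem phi_comp_psi : phi.comp psi = MonoidHom.id H := by
  ext x
  cases x with
  | a => simp
  | b => simpa [mul_assoc] using H_conj_a
  | r => simp

/-- MAIN STATEMENT.  `π₁(P ×_c S¹) = ⟨u, s ∣ [s², u]⟩ ≃* ⟨a, b, r ∣ r a r⁻¹ = b, r b r⁻¹ = a⟩ = F(a,b) ⋊_swap ℤ`. -/
def equivGH : G ≃* H :=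
  MonoidHom.toMulEquiv phi psi psi_comp_phi phi_comp_psi

/-- `equivGH_apply` (generator-level bookkeeping lemma). -/
@[simp] theorem equivGH_apply (g : G) : equivGH g = phi g := rfl

/-! ## Where the section class and the boundary class go -/

/-- The section class `γ_t = u s` is the fibre generator `a`. -/
theorem phi_section :
    phi (PresentedGroup.of false * PresentedGroup.of true) = PresentedGroup.of Gen.a := by
  simp

/-- The second section class `γ_s = v s = s u` is the fibre generator `b = r a r⁻¹`. -/
theorem phi_section' :
    phi (PresentedGroup.of true * PresentedGroup.of false) = PresentedGroup.of Gen.b := by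
  simpa [mul_assoc] using H_conj_a

/-- The boundary class `[∂P] = u² v⁻² = u u s u⁻¹ u⁻¹ s⁻¹` is the commutator `a b a⁻¹ b⁻¹ = [∂T₀]`. -/
theorem phi_boundary :
    phi (PresentedGroup.of false * PresentedGroup.of false * PresentedGroup.of true *
        (PresentedGroup.of false)⁻¹ * (PresentedGroup.of false)⁻¹ * (PresentedGroup.of true)⁻¹) =
      PresentedGroup.of Gen.a * PresentedGroup.of Gen.b * (PresentedGroup.of Gen.a)⁻¹ *
        (PresentedGroup.of Gen.b)⁻¹ := by
  simp only [map_mul, map_inv, phi_of, phiGen_false, phiGen_true]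
  calc PresentedGroup.of Gen.a * (PresentedGroup.of Gen.r)⁻¹ *
          (PresentedGroup.of Gen.a * (PresentedGroup.of Gen.r)⁻¹) * PresentedGroup.of Gen.r *
          (PresentedGroup.of Gen.a * (PresentedGroup.of Gen.r)⁻¹)⁻¹ *
          (PresentedGroup.of Gen.a * (PresentedGroup.of Gen.r)⁻¹)⁻¹ * (PresentedGroup.of Gen.r)⁻¹
        = PresentedGroup.of Gen.a *
            ((PresentedGroup.of Gen.r)⁻¹ * PresentedGroup.of Gen.a * PresentedGroup.of Gen.r) *
            (PresentedGroup.of Gen.a)⁻¹ *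
            (PresentedGroup.of Gen.r * PresentedGroup.of Gen.a * (PresentedGroup.of Gen.r)⁻¹)⁻¹ := by
          group
    _ = PresentedGroup.of Gen.a * PresentedGroup.of Gen.b * (PresentedGroup.of Gen.a)⁻¹ *
          (PresentedGroup.of Gen.b)⁻¹ := by rw [H_conj_a', H_conj_a]

/-! ## The two fibration classes -/

/-- `φ_A = s*` on the generators of `G` (`u ↦ 0`, `s ↦ 1`): the given fibration, fibre `P`. -/
def degAG : Bool → Multiplicative ℤ
  | false => 1
  | true => ofAdd 1

/-- `φ_B = s* − u*` on the generators of `G` (`u ↦ -1`, `s ↦ 1`): the hidden fibration, fibre `T₀`. -/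
def degBG : Bool → Multiplicative ℤ
  | false => ofAdd (-1)
  | true => ofAdd 1

/-- `φ_A` on the generators of `H`: `a, b, r ↦ 1, 1, 1`. -/
def degAH : Gen → Multiplicative ℤ
  | Gen.a => ofAdd 1
  | Gen.b => ofAdd 1
  | Gen.r => ofAdd 1

/-- `φ_B` on the generators of `H`: `a, b ↦ 0`, `r ↦ 1` (so `ker φ_B ⊇ ⟨a, b⟩`). -/
def degBH : Gen → Multiplicative ℤ
  | Gen.a => 1
  | Gen.b => 1
  | Gen.r => ofAdd 1

/-- `degAG_false` (generator-level bookkeeping lemma). -/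
@[simp] theorem degAG_false : degAG false = 1 := rfl
/-- `degAG_true` (generator-level bookkeeping lemma). -/
@[simp] theorem degAG_true : degAG true = ofAdd 1 := rfl
/-- `degBG_false` (generator-level bookkeeping lemma). -/
@[simp] theorem degBG_false : degBG false = ofAdd (-1) := rfl
/-- `degBG_true` (generator-level bookkeeping lemma). -/
@[simp] theorem degBG_true : degBG true = ofAdd 1 := rfl
/-- `degAH_a` (generator-level bookkeeping lemma). -/
@[simp] theorem degAH_a : degAH Gen.a = ofAdd 1 := rfl
/-- `degAH_b` (generator-level bookkeeping lemma). -/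
@[simp] theorem degAH_b : degAH Gen.b = ofAdd 1 := rfl
/-- `degAH_r` (generator-level bookkeeping lemma). -/
@[simp] theorem degAH_r : degAH Gen.r = ofAdd 1 := rfl
/-- `degBH_a` (generator-level bookkeeping lemma). -/
@[simp] theorem degBH_a : degBH Gen.a = 1 := rfl
/-- `degBH_b` (generator-level bookkeeping lemma). -/
@[simp] theorem degBH_b : degBH Gen.b = 1 := rfl
/-- `degBH_r` (generator-level bookkeeping lemma). -/
@[simp] theorem degBH_r : degBH Gen.r = ofAdd 1 := rfl

/-- `φ_A : H →* ℤ`. -/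
def degA : H →* Multiplicative ℤ :=
  PresentedGroup.toGroup (f := degAH) (by
    intro w hw
    simp only [relsH, Set.mem_insert_iff, Set.mem_singleton_iff] at hw
    rcases hw with rfl | rfl
    · simp [relH1, ha, hb, hr]
    · simp [relH2, ha, hb, hr])

/-- `φ_B : H →* ℤ`. -/
def degB : H →* Multiplicative ℤ :=
  PresentedGroup.toGroup (f := degBH) (by
    intro w hw
    simp only [relsH, Set.mem_insert_iff, Set.mem_singleton_iff] at hw
    rcases hw with rfl | rfl
    · simp [relH1, ha, hb, hr]
    · simp [relH2, ha, hb, hr])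

/-- `degA_of` (generator-level bookkeeping lemma). -/
@[simp] theorem degA_of (x : Gen) : degA (PresentedGroup.of x) = degAH x := by simp [degA]
/-- `degB_of` (generator-level bookkeeping lemma). -/
@[simp] theorem degB_of (x : Gen) : degB (PresentedGroup.of x) = degBH x := by simp [degB]

/-- Under `Φ`, `φ_A` is `u ↦ 0`, `s ↦ 1`. -/
theorem degA_comp_phi (x : Bool) : degA (phi (PresentedGroup.of x)) = degAG x := by
  cases x with
  | false => simp
  | true => simp

/-- Under `Φ`, `φ_B` is `u ↦ -1`, `s ↦ 1`. -/
theorem degB_comp_phi (x : Bool) : degB (phi (PresentedGroup.of x)) = degBG x := by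
  cases x with
  | false => simp
  | true => simp

/-- The section class `u s` has `φ_A`-degree `1` (it is a section of `N_P → S¹`) and `φ_B`-degree `0`
(it lies on a fibre of the hidden fibration). -/
theorem section_degrees :
    degA (phi (PresentedGroup.of false * PresentedGroup.of true)) = ofAdd 1 ∧
      degB (phi (PresentedGroup.of false * PresentedGroup.of true)) = 1 := by
  constructor <;> simp

end HiddenFibration
end Summit.SmoothPoincare4.SmoothPoincare4.Theorems
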